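import Summits.ResolutionOfSingularities.ResolutionOfSingularities.Theorems.FrobeniusLadderFInjectiveMacaulayficationPointFloorNotFullOfFedder
import HarnessLib

/-!
# THE p-UNIFORM TWO-TERM FEDDER LIBRARY: `(Z^a + X^b·v)^{p−1} ∈ (X₀^p, …, X_{n−1}^p)` whenever `⌊(p−1)/a⌋ + ⌊(p−1)/b⌋ < p − 1` (e.g. `a = 2`, `b ≥ 3`: EVERY `p`), and the
# point-floor wrapper: a strict transform of two-term shape at the origin of one chart makes EVERY blowing up along the point floor NOT FULL over the closed point
# (crux `FInjectiveMacaulayfication` stmt-ResolutionOfSingularities-15315, chain w45a; res-L1-w45a-plan-1 RULING R22.10 (a) «the p-UNIFORM TWO-TERM FEDDER LIBRARY: generalise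
# ✓p679908 `g_zero_pow_mem_frobeniusPower` to `(z^a + x^b·v)^{p−1} ∈ (z^p, x^p)` under the diagonal non-F-purity condition ⌊(p−1)/a⌋ + ⌊(p−1)/b⌋ < p−1 + the matching
# `pointFloor_not_full_of_twoTermChart` wrapper in `PointFloorNotFullOfFedder` currency — the reusable NOT-FULL half for every future generic-p bed»; seat res-L1-w45a-stub-1 g13)

[OURS · L1 W4.5a] Support file (`--supports stmt-ResolutionOfSingularities-15315 --as helper`); def-free; UNCONDITIONAL; no named fact; NOT a statement of any manuscript.
Nothing of the crux is proved. AI-written (AI review is weaker than expert review).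

* §1 ★ `twoTerm_pow_mem_frobeniusPower` — for indices `z, x : Fin n`, exponents `a, b ≥ 1` with `⌊(p−1)/a⌋ + ⌊(p−1)/b⌋ < p − 1` (natural-number division) and ANY cofactor
  `v`: `(X_z^a + X_x^b·v)^{p−1} ∈ (X₀^p,…,X_{n−1}^p)`. Proof: in the binomial expansion the term `m` is `C·X_z^{am}·(X_x^b v)^{p−1−m}`; if `am ≥ p` it lies in `(X_z^p)`;
  else `m ≤ ⌊(p−1)/a⌋`, and `b(p−1−m) ≤ p−1` would give `p−1−m ≤ ⌊(p−1)/b⌋`, i.e. `p−1 ≤ ⌊(p−1)/a⌋ + ⌊(p−1)/b⌋` — excluded; so `b(p−1−m) ≥ p` and the term lies in `(X_x^p)`.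
  (For `v = 1` the condition is also necessary: all `C(p−1, m) ≢ 0 (mod p)`; this is the diagonal Fedder criterion «`Z^a + X^b` is not F-pure at the origin iff
  `⌊(p−1)/a⌋ + ⌊(p−1)/b⌋ < p−1`», of which only the sufficiency is proved and used here.)
  `floor_half_add_floor_lt` — the instance `a = 2`, `b ≥ 3`: the condition holds for EVERY `p ≥ 2`; `twoTerm_sq_pow_mem_frobeniusPower` — hence
  `(X_z² + X_x^b·v)^{p−1} ∈ 𝔪^{[p]}` for all `p ≥ 2`, `b ≥ 3` (✓p679908ʼs B9 certificate is `b = 7`).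
* §2 ★ `pointFloor_not_full_of_twoTermChart` — `PointFloorNotFullOfFedder.pointFloor_not_full` with the Fedder binders (`hc`, `hfed`) DISCHARGED by a two-term shape
  `g_{i₀} = X_z^a + X_x^b·w` of the `i₀`-th strict transform (`a, b ≥ 1`, floor condition): for EVERY blowing up `g : S′ → Spec 𝒪_{X,v}` along the point floor some stalk over
  the closed point is NOT `FullCl p`; `pointFloor_not_full_of_sqChart` — the `a = 2`, `b ≥ 3` instance, NO condition on `p` (the NOT-FULL half of every generic-p
  double-point bed: B9, the diagonal family `z² + Σ xᵢ^a`, …).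
[folklore; cite: Fedder1983, Prop. 1.7 and Thm. 1.12] [cite: GortzWedhorn2020, Prop. 13.91 (2)]
-/

-- single-problem summit: the doubled namespace component is forced
set_option linter.dupNamespace false

noncomputable section

namespace Summit.ResolutionOfSingularities.ResolutionOfSingularities.Theorems.FInjectiveMacaulayfication.TwoTermFedder

open CategoryTheory CategoryTheory.Limits AlgebraicGeometry TopologicalSpace IsLocalRing MvPolynomial
open Literature.AlgebraicGeometry.Resolution
open Summit.ResolutionOfSingularities.ResolutionOfSingularities.Theorems.FInjectiveMacaulayfication
open SliceableCentre

variable (k : Type) [Field k] {n : ℕ}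

/-! ## §1 The two-term bracket-power membership -/

/-- ★ **THE p-UNIFORM TWO-TERM FEDDER CERTIFICATE**: `(X_z^a + X_x^b·v)^{p−1} ∈ (X₀^p,…,X_{n−1}^p)` for `a, b ≥ 1` with `⌊(p−1)/a⌋ + ⌊(p−1)/b⌋ < p−1` and any `v`.
[folklore; cite: Fedder1983, Prop. 1.7] -/
theorem twoTerm_pow_mem_frobeniusPower (p : ℕ) (z x : Fin n) (a b : ℕ) (ha : 0 < a) (hb : 0 < b) (hab : (p - 1) / a + (p - 1) / b < p - 1)
    (v : MvPolynomial (Fin n) k) :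
    ((X z : MvPolynomial (Fin n) k) ^ a + X x ^ b * v) ^ (p - 1) ∈ Ideal.span (Set.range fun j : Fin n => (X j : MvPolynomial (Fin n) k) ^ p) := by
  have hz : (X z : MvPolynomial (Fin n) k) ^ p ∈ Ideal.span (Set.range fun j : Fin n => (X j : MvPolynomial (Fin n) k) ^ p) := Ideal.subset_span ⟨z, rfl⟩
  have hx : (X x : MvPolynomial (Fin n) k) ^ p ∈ Ideal.span (Set.range fun j : Fin n => (X j : MvPolynomial (Fin n) k) ^ p) := Ideal.subset_span ⟨x, rfl⟩
  rw [add_pow]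
  refine Ideal.sum_mem _ fun m hm => ?_
  rw [Finset.mem_range] at hm
  by_cases h1 : p ≤ a * m
  · -- the `X_z`-degree is at least `p`
    have e1 : ((X z : MvPolynomial (Fin n) k) ^ a) ^ m = X z ^ p * X z ^ (a * m - p) := by
      rw [← pow_mul, ← pow_add]
      congr 1
      omega
    rw [e1, mul_assoc, mul_assoc]
    exact Ideal.mul_mem_right _ _ hz
  · -- then `m ≤ ⌊(p−1)/a⌋`, so the `X_x`-degree `b(p−1−m)` is at least `p`
    have hm1 : m ≤ (p - 1) / a := by
      rw [Nat.le_div_iff_mul_le ha]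
      have h1' : a * m < p := Nat.lt_of_not_le h1
      rw [Nat.mul_comm] at h1'
      omega
    have h2 : p ≤ b * (p - 1 - m) := by
      by_contra h2
      have h2' : b * (p - 1 - m) < p := Nat.lt_of_not_le h2
      have hm2 : p - 1 - m ≤ (p - 1) / b := by
        rw [Nat.le_div_iff_mul_le hb]
        rw [Nat.mul_comm] at h2'
        omega
      omega
    have e2 : ((X x : MvPolynomial (Fin n) k) ^ b * v) ^ (p - 1 - m) = X x ^ p * (X x ^ (b * (p - 1 - m) - p) * v ^ (p - 1 - m)) := by
      rw [mul_pow, ← pow_mul, ← mul_assoc, ← pow_add]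
      congr 2
      omega
    rw [e2, mul_comm (((X z : MvPolynomial (Fin n) k) ^ a) ^ m), mul_assoc, mul_assoc]
    exact Ideal.mul_mem_right _ _ hx

/-- The floor inequality for `a = 2`, `b ≥ 3` holds for every `p ≥ 2`: `⌊(p−1)/2⌋ + ⌊(p−1)/b⌋ ≤ (p−1)/2 + (p−1)/3 < p−1`. [arithmetic] -/
theorem floor_half_add_floor_lt (p b : ℕ) (hp : 2 ≤ p) (hb : 3 ≤ b) : (p - 1) / 2 + (p - 1) / b < p - 1 := by
  have h3 : (p - 1) / b ≤ (p - 1) / 3 := Nat.div_le_div_left hb (by norm_num)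
  omega

/-- ★ **The double-point instance, p-UNIFORM**: `(X_z² + X_x^b·v)^{p−1} ∈ (X₀^p,…,X_{n−1}^p)` for every `p ≥ 2`, `b ≥ 3`, any `v` (B9: `b = 7`; the diagonal family
`z² + Σ xᵢ^a`: `b = a − 2`). [folklore; cite: Fedder1983, Prop. 1.7] -/
theorem twoTerm_sq_pow_mem_frobeniusPower (p : ℕ) (hp : 2 ≤ p) (z x : Fin n) (b : ℕ) (hb : 3 ≤ b) (v : MvPolynomial (Fin n) k) :
    ((X z : MvPolynomial (Fin n) k) ^ 2 + X x ^ b * v) ^ (p - 1) ∈ Ideal.span (Set.range fun j : Fin n => (X j : MvPolynomial (Fin n) k) ^ p) :=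
  twoTerm_pow_mem_frobeniusPower k p z x 2 b (by norm_num) (by omega) (floor_half_add_floor_lt p b hp hb) v

/-! ## §2 ★ The point-floor wrapper -/

/-- ★ **NOT FULL FROM A TWO-TERM CHART** (`PointFloorNotFullOfFedder` currency with the Fedder binders discharged): `f` prime with point-blow-up chart identities
`θᵢ f = Xᵢ^{μᵢ}·gᵢ` (`f, gᵢ ∉ (Xᵢ)`, `f(0) = 0`), and ONE chart `i₀` whose strict transform is `g_{i₀} = X_z^a + X_x^b·w` with `a, b ≥ 1`, `⌊(p−1)/a⌋ + ⌊(p−1)/b⌋ < p−1`: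
for EVERY blowing up `g : S′ → Spec 𝒪_{X,v}` along the point floor `𝔪̃|_{Spec 𝒪_{X,v}}` some stalk of `S′` over the closed point is NOT `FullCl p`.
[folklore assembly; cite: Fedder1983, Thm. 1.12] [cite: GortzWedhorn2020, Prop. 13.91 (2)] -/
theorem pointFloor_not_full_of_twoTermChart (p : ℕ) [Fact p.Prime] [CharP k p] (f : MvPolynomial (Fin n) k) (hf : Prime f) (μ : Fin n → ℕ)
    (g : Fin n → MvPolynomial (Fin n) k)
    (hθ : ∀ i : Fin n, aeval (fun j : Fin n => if j = i then (X i : MvPolynomial (Fin n) k) else X j * X i) f = X i ^ μ i * g i)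
    (hfX : ∀ i : Fin n, f ∉ Ideal.span {(X i : MvPolynomial (Fin n) k)}) (hgX : ∀ i : Fin n, g i ∉ Ideal.span {(X i : MvPolynomial (Fin n) k)})
    (hf0 : constantCoeff f = 0) (i₀ z x : Fin n) (a b : ℕ) (ha : 0 < a) (hb : 0 < b) (hab : (p - 1) / a + (p - 1) / b < p - 1)
    (w : MvPolynomial (Fin n) k) (hgi : g i₀ = X z ^ a + X x ^ b * w)
    (v : Spec (.of (MvPolynomial (Fin n) k ⧸ Ideal.span {f}))) (hv : v.asIdeal = Ideal.span (Set.range (fun j : Fin n => Ideal.Quotient.mk (Ideal.span {f}) (X j))))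
    (S' : Scheme.{0}) (g' : S' ⟶ Spec ((Spec (.of (MvPolynomial (Fin n) k ⧸ Ideal.span {f}))).presheaf.stalk v))
    (hg' : IsBlowup g' ((affineBlowup.idealSheaf (Ideal.span (Set.range (fun j : Fin n => Ideal.Quotient.mk (Ideal.span {f}) (X j))))).comap
      ((Spec (.of (MvPolynomial (Fin n) k ⧸ Ideal.span {f}))).fromSpecStalk v))) :
    ∃ s : S', g'.base s = closedPoint ((Spec (.of (MvPolynomial (Fin n) k ⧸ Ideal.span {f}))).presheaf.stalk v) ∧ ¬ FullCl p (S'.presheaf.stalk s) := by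
  have hc : constantCoeff (g i₀) = 0 := by
    rw [hgi, map_add, map_mul, map_pow, map_pow, constantCoeff_X, constantCoeff_X, zero_pow ha.ne', zero_pow hb.ne', zero_mul, add_zero]
  have hfed : g i₀ ^ (p - 1) ∈ Ideal.span (Set.range fun j : Fin n => (X j : MvPolynomial (Fin n) k) ^ p) := by
    rw [hgi]
    exact twoTerm_pow_mem_frobeniusPower k p z x a b ha hb hab w
  exact PointFloorNotFullOfFedder.pointFloor_not_full p k f hf μ g hθ hfX hgX hf0 i₀ hc hfed v hv S' g' hg'

/-- ★ **NOT FULL FROM A DOUBLE-POINT CHART, EVERY `p`**: the instance `g_{i₀} = X_z² + X_x^b·w`, `b ≥ 3` — no condition on the prime `p`. [folklore assembly;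
cite: Fedder1983, Thm. 1.12] -/
theorem pointFloor_not_full_of_sqChart (p : ℕ) [Fact p.Prime] [CharP k p] (f : MvPolynomial (Fin n) k) (hf : Prime f) (μ : Fin n → ℕ)
    (g : Fin n → MvPolynomial (Fin n) k)
    (hθ : ∀ i : Fin n, aeval (fun j : Fin n => if j = i then (X i : MvPolynomial (Fin n) k) else X j * X i) f = X i ^ μ i * g i)
    (hfX : ∀ i : Fin n, f ∉ Ideal.span {(X i : MvPolynomial (Fin n) k)}) (hgX : ∀ i : Fin n, g i ∉ Ideal.span {(X i : MvPolynomial (Fin n) k)})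
    (hf0 : constantCoeff f = 0) (i₀ z x : Fin n) (b : ℕ) (hb : 3 ≤ b) (w : MvPolynomial (Fin n) k) (hgi : g i₀ = X z ^ 2 + X x ^ b * w)
    (v : Spec (.of (MvPolynomial (Fin n) k ⧸ Ideal.span {f}))) (hv : v.asIdeal = Ideal.span (Set.range (fun j : Fin n => Ideal.Quotient.mk (Ideal.span {f}) (X j))))
    (S' : Scheme.{0}) (g' : S' ⟶ Spec ((Spec (.of (MvPolynomial (Fin n) k ⧸ Ideal.span {f}))).presheaf.stalk v))
    (hg' : IsBlowup g' ((affineBlowup.idealSheaf (Ideal.span (Set.range (fun j : Fin n => Ideal.Quotient.mk (Ideal.span {f}) (X j))))).comap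
      ((Spec (.of (MvPolynomial (Fin n) k ⧸ Ideal.span {f}))).fromSpecStalk v))) :
    ∃ s : S', g'.base s = closedPoint ((Spec (.of (MvPolynomial (Fin n) k ⧸ Ideal.span {f}))).presheaf.stalk v) ∧ ¬ FullCl p (S'.presheaf.stalk s) :=
  pointFloor_not_full_of_twoTermChart k p f hf μ g hθ hfX hgX hf0 i₀ z x 2 b (by norm_num) (by omega)
    (floor_half_add_floor_lt p b (Fact.out : p.Prime).two_le hb) w hgi v hv S' g' hg'

end Summit.ResolutionOfSingularities.ResolutionOfSingularities.Theorems.FInjectiveMacaulayfication.TwoTermFedder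

end
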